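import Summits.BirchSwinnertonDyer.BirchSwinnertonDyer.Theorems.KatoDescentPotSupersingularKatoSelmerSSide
import Summits.BirchSwinnertonDyer.BirchSwinnertonDyer.Theorems.KatoDescentPotSupersingularASideJunction
import Summits.BirchSwinnertonDyer.BirchSwinnertonDyer.Theorems.KatoDescentPotSupersingularH1TateTorsion
import HarnessLib

/-!
# The A⊕S ledger of crux M at the zeta line: for `k ≫ 0`,
# `#Sel_{p^∞}(E/ℚ) · ∏_{ℓ∈T∖{p}} #H¹_ur(ℚ_ℓ,E[p^∞]) · [B_k(ℤ_p y₀) : B_k(ℤ_p y₀) ⊓ 𝓚_k^⊥] · [A : ℤ_p y₀] ≤ #Sel_str^{ur}(E[p^∞]) · p^k · [E(ℚ):p^kE(ℚ)] · #E(ℚ)[p^N]`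
# (route `KatoDescentPotSupersingular` / `…Tame…`, crux M = stmt-BirchSwinnertonDyer-19196; route-free helper)

Seat `bsd-potss-rkm` g20 (prover; cell `bsd-potss`), item stmt-BirchSwinnertonDyer-19196 (`--supports … --as helper`; closes nothing).
HONEST FRAMING: BSD is not proved by any of this; nothing is booked; theorems only (no definition, no named fact).

## What

The S-side of crux M's level-0 ledger (part 46, `exists_forall_sSide_le`, Kato Prop. 14.16 (2) steps (ii)×(iii)) bounds
`#Sel_{p^∞} · ∏#H¹_ur · #im_k(A)` with `#im_k(A) = [B_k(A) : B_k(A) ⊓ 𝓚_k^⊥]`, `A = H¹(ℤ[1/p], T_pE)` (`integralH1`),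
`B_k(X) = loc_p ((desc^♭)_* (ι′_* red_{p^k} X))`.  Step (iv) of Kato's proof (p. 245) passes from `A` to the zeta line `ℤ_p z ⊆ A`:
`[H¹_{/f}(ℚ_p,T) : loc_p A] · [A : z] = [H¹_{/f} : z_p] · #A_tors`.  In the tree's finite-level currency this is the junction of part 47
(`ASideJunction.relIndex_map_mul_relIndex_le`) applied to `f_k = loc_p ∘ (desc^♭)_* ∘ ι′_* ∘ red_{p^k}`, `K' = 𝓚_k^⊥`, `Y = ℤ_p y₀ ≤ A`,
`n = p^N`, with the torsion factor `#(A ⊓ H¹(ℚ,T_pE)[p^N]) ≤ #E(ℚ)[p^N]` of part 48: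

* **`exists_forall_aSide_le`** — `p` odd, `T ∋ v_p` off which `W` is good, `Sel_{p^∞}(E/ℚ)` and `Ш[p^∞]` finite, Kato's structures
  `𝓤∞`/`𝓢∞`, an element `y₀ ∈ A` and `N` with `p^N · A ⊆ ℤ_p y₀` (finite index of the zeta line — Kato Thm. 14.5 (2), the `index_ne_zero`
  clause; form supplied by `ASideJunction.index_smul_mem_span_singleton`).  THEN `∃ j s k₀, ∀ k ≥ k₀`, for every Poitou–Tate family / Weil datum at
  the two auxiliary levels (as in part 46) such that the level-`k` map satisfies the ZETA-LINE SATURATION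
  `ℤ_p y₀ ∩ f_k⁻¹(𝓚_k^⊥) ⊆ p^N · ℤ_p y₀` (hypothesis `hY`; this is the finite-level shape of brick (b): `[H¹_{/f}(ℚ_p,T_pE) : ℤ_p loc_p y₀] = p^e`
  at a level `k ≥ N + e`, Kato Lemma 14.18 with the value of the dual exponential — NOT proved here):
  `#Sel_{p^∞} · ∏_{ℓ∈T∖{p}} #H¹_ur(ℚ_ℓ,E[p^∞]) · [B_k(ℤ_p y₀) : B_k(ℤ_p y₀) ⊓ 𝓚_k^⊥] · [A : ℤ_p y₀] ≤ #Sel_str^{ur} · p^k · [E(ℚ) : p^k E(ℚ)] · #E(ℚ)[p^N]`.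

READING (rank `0`, `k ≫ 0`: `Sel_{p^∞} = Ш[p^∞]`, `[E(ℚ):p^kE(ℚ)] = #E(ℚ)[p^∞] = p^{t₀}`, `#E(ℚ)[p^N] ≤ p^{t₀}`, g18's Néron reading
`∏#H¹_ur ≥ p^{v_p(Tam) − v_p(c_p)}`, and brick (b) `[B_k(ℤ_p y₀) : B_k(ℤ_p y₀) ⊓ 𝓚_k^⊥] = p^{k−e}`, `e = a + v_p(λ(0)) + t_p − v_p(c_p)`):
`ord_p #Ш + v_p(Tam) + ord_p [A : ℤ_p y₀] ≤ a + v_p(λ(0)) + (ord_p #Sel_str^{ur} + t_p − t₀) + 3t₀` — which IS the `count` clause of the held package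
`Kato2004.MemberHullZetaInputs` (item 20297) with `ord_p #(𝐇²/X𝐇²)` replaced by `ord_p #Sel_str^{ur}(E[p^∞]) + t_p − t₀ = ord_p #H²(ℤ[1/p],T_pE)`
((14.14.2) + (14.9.3)).  So after this file the `count` clause is kernel modulo exactly (b′) the zeta-line index at `p` and (c2′) the
identification `#(𝐇²/X𝐇²) = #Sel_str^{ur}·p^{t_p−t₀}` — both printed statements about Kato's objects, neither equivalent to M.

References: K. Kato, Astérisque 295 (2004), §14.8, Prop. 14.16 and its proof (pp. 244–245), Lemma 14.18 (pp. 247–248), Thm. 14.5 (2) (p. 236)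
[Kato2004Asterisque]; J. S. Milne, *ADT* I Cor. 2.3, Thm. 2.6, Lemma 3.3, Thm. 4.10 (b) [MilneADT2006].
-/

-- the summit and its single problem are both named `BirchSwinnertonDyer` (registry layout D-0017)
set_option linter.dupNamespace false
set_option autoImplicit false

noncomputable section

open scoped Classical ContRepresentation NumberField AddSubgroup
open CategoryTheory Function Field NumberField IsDedekindDomain WeierstrassCurve
open Literature.NumberTheory.EllipticCurves Literature.NumberTheory.GaloisRepresentations
  Literature.NumberTheory.GaloisRepresentations.DiscreteGaloisModule Literature.NumberTheory.GaloisCohomology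
open Literature.NumberTheory.EllipticCurves.Kato2004 Literature.NumberTheory.EllipticCurves.Kato2004.EulerSystemValues
open Summit.BirchSwinnertonDyer.Rank1Residual.X11b.Levels Summit.BirchSwinnertonDyer.Rank1Residual.X11b.LocBridge
  Summit.BirchSwinnertonDyer.Rank1Residual.X11b.LevelKummer Summit.BirchSwinnertonDyer.Rank1Residual.X11b.FiniteDuality
  Summit.BirchSwinnertonDyer.Rank1Residual.X11b.AcSelmer
open Summit.BirchSwinnertonDyer.Rank1Residual.GaloisImage
open Summit.BirchSwinnertonDyer.BirchSwinnertonDyer.Theorems.KummerTowerOrthogonal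
open Summit.BirchSwinnertonDyer.BirchSwinnertonDyer.Theorems.ASideJunction
open Summit.BirchSwinnertonDyer.BirchSwinnertonDyer.Theorems.H1TateTorsion

namespace Summit.BirchSwinnertonDyer.BirchSwinnertonDyer.Theorems.KatoFiniteLevelCount

section Arith

/-- The arithmetic of the assembly: `S·rA ≤ R`, `rY·i ≤ rA·t`, `t ≤ t'` give `S·rY·i ≤ R·t'`. [folklore] -/
theorem mul_junction_le {S rA R rY i t t' : ℕ} (h1 : S * rA ≤ R) (hj : rY * i ≤ rA * t) (ht : t ≤ t') :
    S * rY * i ≤ R * t' :=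
  calc S * rY * i = S * (rY * i) := mul_assoc _ _ _
    _ ≤ S * (rA * t) := Nat.mul_le_mul_left _ hj
    _ = S * rA * t := (mul_assoc _ _ _).symm
    _ ≤ R * t := Nat.mul_le_mul_right _ h1
    _ ≤ R * t' := Nat.mul_le_mul_left _ ht

end Arith

section ASide

variable (W : WeierstrassCurve ℚ) [W.IsElliptic] (p : ℕ) [Fact p.Prime] [ContinuousSMul ℤ_[p] (W.tateModule p)]
  (𝓤inf 𝓢inf : SelmerStructure (primaryGaloisModule W p))

/-- **THE A⊕S LEDGER OF CRUX M AT THE ZETA LINE: `#Sel_{p^∞} · ∏_{ℓ∈T∖{p}} #H¹_ur(ℚ_ℓ,E[p^∞]) · [B_k(ℤ_p y₀) : B_k(ℤ_p y₀) ⊓ 𝓚_k^⊥] · [A : ℤ_p y₀]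
≤ #Sel_str^{ur} · p^k · [E(ℚ) : p^k E(ℚ)] · #E(ℚ)[p^N]`** for all `k ≥ k₀` — part 46 (S-side) × part 47 (junction at `f_k`, `Y = ℤ_p y₀`, `n = p^N`)
× part 48 (`#(A ⊓ H¹(ℚ,T_pE)[p^N]) ≤ #E(ℚ)[p^N]`).  Hypotheses: those of part 46; `y₀ ∈ A = H¹(ℤ[1/p],T_pE)` with `p^N A ⊆ ℤ_p y₀`; and, at the
level `k`, the zeta-line saturation `hY` (`ℤ_p y₀ ∩ f_k⁻¹(𝓚_k^⊥) ⊆ p^N ℤ_p y₀` — the finite-level form of Kato's Lemma 14.18 + value, displayed, not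
proved).  Rank-`0` reading: `ord Ш + v_p Tam + ord [A : ℤ_p y₀] ≤ (ord #Sel_str^{ur} + t_p − t₀) + e + 3t₀ − t_p + v_p(c_p)` with `p^{k−e}` the zeta-line
index, i.e. the `count` clause of `MemberHullZetaInputs` modulo (b′) and (c2′) (module docstring).
[cite: Kato2004Asterisque, §14.8 (p. 238), Prop. 14.16 and its proof (pp. 244–245), Lemma 14.18 (pp. 247–248), Thm. 14.5 (2) (p. 236)]
[cite: MilneADT2006, Ch. I, Cor. 2.3, Lemma 3.3, Thm. 4.10 (b)] -/
theorem exists_forall_aSide_le (hodd : p ≠ 2) (T : Finset (HeightOneSpectrum (𝓞 ℚ)))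
    (hpT : primePlace p ∈ T) (hT : ∀ v : HeightOneSpectrum (𝓞 ℚ), v ∉ T → W.HasGoodReductionAt v)
    [Finite (W.selmerGroupPInfty p)] [Finite (AddCommGroup.primaryComponent (↥W.sha) p)]
    (hUp : 𝓤inf (Sum.inr (primePlace p)) = ⊤)
    (hUur : ∀ v : HeightOneSpectrum (𝓞 ℚ), v ≠ primePlace p →
      𝓤inf (Sum.inr v) = unramifiedSubgroup (GaloisRep.toLocal v (primaryGaloisModule W p)) 1)
    (hUinl : ∀ w : InfinitePlace ℚ, 𝓤inf (Sum.inl w) = ⊤)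
    (hSp : 𝓢inf (Sum.inr (primePlace p)) = ⊥)
    (hSur : ∀ v : HeightOneSpectrum (𝓞 ℚ), v ≠ primePlace p →
      𝓢inf (Sum.inr v) = unramifiedSubgroup (GaloisRep.toLocal v (primaryGaloisModule W p)) 1)
    (hSinl : ∀ w : InfinitePlace ℚ, 𝓢inf (Sum.inl w) = ⊤)
    (y₀ : H1 (tateRep W p) ⊤) (hy₀ : y₀ ∈ integralH1 (tateRep W p) p ⊤) (N : ℕ)
    (hN : ∀ a ∈ integralH1 (tateRep W p) p ⊤, ((p ^ N : ℕ) : ℤ) • a ∈ (ℤ_[p] ∙ y₀).toAddSubgroup) :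
    ∃ j s k₀ : ℕ, ∀ k : ℕ, k₀ ≤ k →
      haveI := neZero_pow p j; haveI := neZero_pow p s; haveI := neZero_pow p k
      haveI : Finite (geomTorsion W ((p ^ k : ℕ) : ℤ)) := finite_geomTorsion_pow W p k
      haveI : Finite (geomTorsion W ((p ^ s * p ^ k : ℕ) : ℤ)) :=
        W.finite_torsionPoints_holds (AlgebraicClosure ℚ) (Int.natCast_ne_zero.mpr (NeZero.ne (p ^ s * p ^ k)))
      ∀ (inv : LocalInvariants ℚ (p ^ j * p ^ k)), inv.SumLocalTermEqZero → inv.IsPerfect →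
      ∀ (ε : geomTorsion W ((p ^ j * p ^ k : ℕ) : ℤ) → geomTorsion W ((p ^ j * p ^ k : ℕ) : ℤ) → AlgebraicClosure ℚ)
        (hμ : ∀ S T, ε S T ^ (p ^ j * p ^ k) = 1)
        (hadd₁ : ∀ S₁ S₂ T, ε (S₁ + S₂) T = ε S₁ T * ε S₂ T)
        (hadd₂ : ∀ S T₁ T₂, ε S (T₁ + T₂) = ε S T₁ * ε S T₂)
        (hgal : ∀ (σ : absoluteGaloisGroup ℚ) (S T : geomTorsion W ((p ^ j * p ^ k : ℕ) : ℤ)), σ • ε S T = ε (σ • S) (σ • T)),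
      -- the zeta-line saturation at level `k` (brick (b), displayed): `ℤ_p y₀ ∩ f_k⁻¹(𝓚_k^⊥) ⊆ p^N ℤ_p y₀`
      (∀ y ∈ (ℤ_[p] ∙ y₀).toAddSubgroup,
        ((galoisCohomology.localization ((W.torsionGaloisModule ((p ^ k : ℕ) : ℤ)).tateDual (p ^ j * p ^ k))
              (Sum.inr (primePlace p)) 1).comp
            ((galoisCohomology.map (DiscreteGaloisModule.pairingDualIntertwining
                (ρ₁ := W.torsionGaloisModule ((p ^ k : ℕ) : ℤ)) (ρ₂ := W.torsionGaloisModule ((p ^ k : ℕ) : ℤ))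
                (B := descendHom W (p ^ j) (p ^ k) ε hμ hadd₁ hadd₂)
                (descendHom_smul W (p ^ j) (p ^ k) ε hμ hadd₁ hadd₂ hgal)) 1).comp
              (((galoisCohomology.map (W.torsionInclusion (intPow_dvd_natCast_pow p k)) 1).comp
                  (ofTopSubgroup (W.torsionGaloisModule ((p : ℤ) ^ k)).toTopRep 1).hom.toLinearMap.toAddMonoidHom).comp
                (reduceH1Pk W p k ⊤)))) y ∈
          annRight (localTatePairingZMod (W.torsionGaloisModule ((p ^ k : ℕ) : ℤ)) (p ^ j * p ^ k)
            (Sum.inr (primePlace p)) (inv (Sum.inr (primePlace p))))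
            (W.kummerSelmerStructure ((p ^ k : ℕ) : ℤ) (Sum.inr (primePlace p))) →
        ∃ y' ∈ (ℤ_[p] ∙ y₀).toAddSubgroup, ((p ^ N : ℕ) : ℤ) • y' = y) →
      ∀ (e : geomTorsion W ((p ^ s * p ^ k : ℕ) : ℤ) → geomTorsion W ((p ^ s * p ^ k : ℕ) : ℤ) → AlgebraicClosure ℚ)
        (hμ' : ∀ S T, e S T ^ (p ^ s * p ^ k) = 1)
        (hadd₁' : ∀ S₁ S₂ T, e (S₁ + S₂) T = e S₁ T * e S₂ T)
        (hadd₂' : ∀ S T₁ T₂, e S (T₁ + T₂) = e S T₁ * e S T₂)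
        (hgal' : ∀ (σ : absoluteGaloisGroup ℚ) (S T : geomTorsion W ((p ^ s * p ^ k : ℕ) : ℤ)), σ • e S T = e (σ • S) (σ • T)),
        (∀ P, e P P = 1) → (∀ P, (∀ Q, e Q P = 1) → P = 0) →
      ∀ (inv' : LocalInvariants ℚ (p ^ s * p ^ k)), inv'.IsPerfect → inv'.SelmerComplement →
      Nat.card (W.selmerGroupPInfty p) *
            (∏ v ∈ T \ {primePlace p}, Nat.card (unramifiedSubgroup (GaloisRep.toLocal v (primaryGaloisModule W p)) 1)) *
            ((((ℤ_[p] ∙ y₀).toAddSubgroup.map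
                  (((galoisCohomology.map (W.torsionInclusion (intPow_dvd_natCast_pow p k)) 1).comp
                      (ofTopSubgroup (W.torsionGaloisModule ((p : ℤ) ^ k)).toTopRep 1).hom.toLinearMap.toAddMonoidHom).comp
                    (reduceH1Pk W p k ⊤))).map
                  (galoisCohomology.map (DiscreteGaloisModule.pairingDualIntertwining
                    (ρ₁ := W.torsionGaloisModule ((p ^ k : ℕ) : ℤ)) (ρ₂ := W.torsionGaloisModule ((p ^ k : ℕ) : ℤ))
                    (B := descendHom W (p ^ j) (p ^ k) ε hμ hadd₁ hadd₂)
                    (descendHom_smul W (p ^ j) (p ^ k) ε hμ hadd₁ hadd₂ hgal)) 1)).map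
                (galoisCohomology.localization ((W.torsionGaloisModule ((p ^ k : ℕ) : ℤ)).tateDual (p ^ j * p ^ k))
                  (Sum.inr (primePlace p)) 1) ⊓
              annRight (localTatePairingZMod (W.torsionGaloisModule ((p ^ k : ℕ) : ℤ)) (p ^ j * p ^ k)
                (Sum.inr (primePlace p)) (inv (Sum.inr (primePlace p))))
                (W.kummerSelmerStructure ((p ^ k : ℕ) : ℤ) (Sum.inr (primePlace p)))).relIndex
              ((((ℤ_[p] ∙ y₀).toAddSubgroup.map
                  (((galoisCohomology.map (W.torsionInclusion (intPow_dvd_natCast_pow p k)) 1).comp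
                      (ofTopSubgroup (W.torsionGaloisModule ((p : ℤ) ^ k)).toTopRep 1).hom.toLinearMap.toAddMonoidHom).comp
                    (reduceH1Pk W p k ⊤))).map
                  (galoisCohomology.map (DiscreteGaloisModule.pairingDualIntertwining
                    (ρ₁ := W.torsionGaloisModule ((p ^ k : ℕ) : ℤ)) (ρ₂ := W.torsionGaloisModule ((p ^ k : ℕ) : ℤ))
                    (B := descendHom W (p ^ j) (p ^ k) ε hμ hadd₁ hadd₂)
                    (descendHom_smul W (p ^ j) (p ^ k) ε hμ hadd₁ hadd₂ hgal)) 1)).map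
                (galoisCohomology.localization ((W.torsionGaloisModule ((p ^ k : ℕ) : ℤ)).tateDual (p ^ j * p ^ k))
                  (Sum.inr (primePlace p)) 1)) *
            ((ℤ_[p] ∙ y₀).toAddSubgroup.relIndex (integralH1 (tateRep W p) p ⊤).toAddSubgroup) ≤
        Nat.card 𝓢inf.selmerGroup * p ^ k *
          (zsmulAddGroupHom ((p ^ k : ℕ) : ℤ) : W.toAffine.Point →+ W.toAffine.Point).range.index *
          Nat.card ↥(W.toAffine.Point[((p ^ N : ℕ) : ℤ)]) := by
  obtain ⟨j, s, k₀, hS⟩ := exists_forall_sSide_le W p 𝓤inf 𝓢inf hodd T hpT hT hUp hUur hUinl hSp hSur hSinl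
  refine ⟨j, s, k₀, fun k hk => ?_⟩
  intro inv hsum hperf ε hμ hadd₁ hadd₂ hgal hY e hμ' hadd₁' hadd₂' hgal' halt hnondeg inv' hperf' hcompl'
  have h1 := hS k hk inv hsum hperf ε hμ hadd₁ hadd₂ hgal e hμ' hadd₁' hadd₂' hgal' halt hnondeg inv' hperf' hcompl'
  -- the junction (part 47) at `f_k = loc_p ∘ (desc^♭)_* ∘ (ι′_* ∘ red_{p^k})`, `Y = ℤ_p y₀ ≤ A`, `n = p^N`
  have hYA : (ℤ_[p] ∙ y₀).toAddSubgroup ≤ (integralH1 (tateRep W p) p ⊤).toAddSubgroup := by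
    intro x hx
    rw [Submodule.mem_toAddSubgroup, Submodule.mem_span_singleton] at hx
    obtain ⟨c, rfl⟩ := hx
    exact (integralH1 (tateRep W p) p ⊤).smul_mem c hy₀
  haveI := finite_inf_torsionBy W (integralH1 (tateRep W p) p ⊤).toAddSubgroup N
  have hj := relIndex_map_mul_relIndex_le _ _ _ _ hYA ((p ^ N : ℕ) : ℤ) hN hY
  simp only [AddSubgroup.map_map] at h1 ⊢
  -- the torsion factor (part 48) and the assembly `S₀·r(Y)·[A:Y] ≤ S₀·r(A)·#T ≤ R·#T ≤ R·#E(ℚ)[p^N]`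
  exact mul_junction_le h1 hj (natCard_inf_torsionBy_le_natCard_torsionBy_point W (integralH1 (tateRep W p) p ⊤).toAddSubgroup N)

end ASide

end Summit.BirchSwinnertonDyer.BirchSwinnertonDyer.Theorems.KatoFiniteLevelCount

end
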